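import Summits.QuantumFields.BalabanUV.T4Continuum.Support.NE3TorusProjection
import Summits.QuantumFields.BalabanUV.T4Continuum.Support.NE3StraightAverageSplit
import HarnessLib

/-!
# T⁴ programme, node NE3 — row E-MLw-(w4)-P, sub-row Φ6 (flat), PROJECTED-LANDAU variant, file 1: THE ℓ²-PROJECTION ONTO THE
# CORNER-TRIVIAL GAUGE ORBIT AND THE VANISHING OF THE DIVERGENCE OFF THE BLOCK CORNERS (abstract, `E`-valued)

NE3 (node U1b) formalisation swarm `b2b-balaban-t4-ne3-formalise-*`, leaf seat `b2b-balaban-t4-ne3-formalise-leaf-01`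
(gen 5), row **Φ6** of rulings ρ-g21-3 ∕ ρ-g21-4 (W2)(W4) («the chart's slice for curl-currency statements = the ℓ²-MIN-NORM slice
T(W) = projected Landau»; «Φ6-flat … `⊕ T_pt`»); division with leaf-02-g5 (journal ≈15:50Z ∕ ≈15:58Z: «T_pt MINE»).  Companion of
`NE3TorusProjection` (the block-mean-zero variant for the frame-free slice `T_♮`).

WHAT.  `T_pt(1)` = the flat k-fold tangent directions whose backward divergence VANISHES OFF THE BLOCK CORNERS `(L^k)•ℤ^d`; its
gauge complement is `dPot Ξ₀`, `Ξ₀` = the CORNER-TRIVIAL site fields (no block-mean condition).  THIS FILE is the abstract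
half for a finite-dimensional real inner product space `E`:
§1 the sub-module `xiSub₀` (corner-trivial torus site fields) and **`exists_orthogonal_repr₀`** — every lattice 1-form `Y` has a
   periodic corner-trivial `ξ` with `Y + cobd ξ ⊥ cobd η` on `periodBox (M·N)` for all periodic corner-trivial `η`
   (`Submodule.exists_add_mem_mem_orthogonal` in `PiLp 2`, as in `NE3TorusProjection.exists_orthogonal_repr`);
§2 **`eq_zero_offCorner_of_orthogonal`** — a periodic site function orthogonal to every periodic corner-trivial `η` VANISHES off
   the corners (test field `𝟙_{non-corner}·f`); `sum_inner_cobd_eq_neg` (periodic summation by parts, all directions, from (70S));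
§3 **`exists_projLandau_repr`** — every `(M·N)`-periodic `E`-valued 1-form `Y` has a periodic corner-trivial `ξ` with the
   backward divergence of `Y + cobd ξ` equal to ZERO at every non-corner site.
(File 2 `NE3ProjectedLandauRepr`: matrices, skewness, tangency, and the trivial intersection `dPot Ξ₀ ∩ T_pt(1) = {0}`.)

HONEST FRAMING.  Flat finite-dimensional linear algebra on our lattice objects; nothing about Bałaban's minimisers; (P♮), (ML_w) at
W ≠ 1, T-E_w and **NE3 are NOT proved**; spine PROVED 0∕9; finite T⁴ rung (B)+1 — NOT infinite volume, NOT mass gap, NOT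
`BetaPertH`, NOT Clay.  PLACEMENT: `Summits/QuantumFields/BalabanUV/`.  HONEST DEPENDENCY (cell page 1): continuum YM on T⁴ ⇐
BetaPertH ∧ nine spine estimates (0/9 proved); BetaPertH ⇐ (D1) ∧ (D4) ∧ CAP+tail; G-an2-4 gates asym, D1 and NE2/3/4.
-/

set_option autoImplicit false

open scoped BigOperators InnerProductSpace
open Finset

namespace Summit.QuantumFields.BalabanUV.T4Continuum.NE3ProjectedLandauProjection

open Literature.MathematicalPhysics.QuantumFieldTheory.Balaban1983to89
open B7Prop1Explicit
open T4AveragingDeficitWallBoundary (periodBox mem_periodBox)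
open AveragingDeficitTorusChart (redN eq_wrap_add periodic_smul_vec)
open SkeletonLattice (cdiv cmod cdiv_add_period cmod_add_period)
open NE3BlockLineAverage (sum_periodBox_blocks)
open NE3StraightAverageAdjoint (cdiv_cmod_block)
open NE3StraightAverageSplit (sum_inner_fd_eq_neg)
open NE3TorusProjection (cobd extT extT_add extT_smul extT_zero extT_add_period extT_toLp_eq resT1 resT1_apply inner_resT1
  dPotT dPotT_apply)

noncomputable section

variable {d : ℕ}
variable {E : Type*} [NormedAddCommGroup E] [InnerProductSpace ℝ E]

/-! ## §1 The corner-trivial sub-module and the orthogonal representative -/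

variable (d E) in
/-- **`Ξ₀`**: the torus site fields whose periodic extension vanishes on the corner lattice `M•ℤ^d` — a real sub-module. [folklore] -/
def xiSub₀ (M P : ℕ) [NeZero P] : Submodule ℝ (PiLp 2 (fun _ : (Fin d → Fin P) => E)) where
  carrier := {a | ∀ w : Site d, extT P a ((M : ℤ) • w) = 0}
  zero_mem' := fun _ => rfl
  add_mem' := by
    intro a b ha hb w
    rw [Set.mem_setOf_eq] at ha hb
    rw [extT_add, ha, hb, add_zero]
  smul_mem' := by
    intro c a ha w
    rw [Set.mem_setOf_eq] at ha
    rw [extT_smul, ha, smul_zero]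

/-- Membership in `Ξ₀`, unfolded. [folklore] -/
theorem mem_xiSub₀ {M P : ℕ} [NeZero P] {a : PiLp 2 (fun _ : (Fin d → Fin P) => E)} :
    a ∈ xiSub₀ d E M P ↔ ∀ w : Site d, extT P a ((M : ℤ) • w) = 0 := Iff.rfl

/-- **THE ℓ²-PROJECTION ONTO THE CORNER-TRIVIAL GAUGE ORBIT**: `M, N ≥ 1`, `E` finite-dimensional; every lattice 1-form `Y`
has an `(M·N)`-periodic CORNER-TRIVIAL `ξ` such that `Y + cobd ξ` is `ℓ²(periodBox (M·N))`-orthogonal to `cobd η` for every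
`(M·N)`-periodic corner-trivial `η`. [folklore] -/
theorem exists_orthogonal_repr₀ [FiniteDimensional ℝ E] {M N : ℕ} (hM : 1 ≤ M) (hN : 1 ≤ N) (Y : Site d → Fin d → E) :
    ∃ ξ : Site d → E,
      (∀ (x : Site d) (τ : Fin d), ξ (x + ((M * N : ℕ) : ℤ) • e τ) = ξ x) ∧
      (∀ w : Site d, ξ ((M : ℤ) • w) = 0) ∧
      ∀ η : Site d → E, (∀ (x : Site d) (τ : Fin d), η (x + ((M * N : ℕ) : ℤ) • e τ) = η x) →
        (∀ w : Site d, η ((M : ℤ) • w) = 0) →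
        ∑ x ∈ periodBox (d := d) (M * N), ∑ κ : Fin d, ⟪cobd η x κ, Y x κ + cobd ξ x κ⟫_ℝ = 0 := by
  set P : ℕ := M * N with hPdef
  haveI : NeZero P := ⟨by positivity⟩
  set K : Submodule ℝ (PiLp 2 (fun _ : (Fin d → Fin P) × Fin d => E)) := (xiSub₀ d E M P).map (dPotT P) with hK
  haveI : CompleteSpace K := FiniteDimensional.complete ℝ K
  obtain ⟨r, hr, zz, hz, hyz⟩ := K.exists_add_mem_mem_orthogonal (resT1 P Y)
  obtain ⟨a, ha, har⟩ := Submodule.mem_map.1 hr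
  rw [mem_xiSub₀] at ha
  refine ⟨fun x => -extT P a x, fun x τ => ?_, fun w => ?_, fun η hηP hηc => ?_⟩
  · show -extT P a (x + ((M * N : ℕ) : ℤ) • e τ) = -extT P a x
    rw [← hPdef, extT_add_period]
  · show -extT P a ((M : ℤ) • w) = 0
    rw [ha, neg_zero]
  · set b : PiLp 2 (fun _ : (Fin d → Fin P) => E) := WithLp.toLp 2 fun s : Fin d → Fin P => η (boxVec P s) with hb
    have hbext : extT P b = η := funext fun x => extT_toLp_eq P hηP x
    have hbmem : b ∈ xiSub₀ d E M P := by rw [mem_xiSub₀, hbext]; exact hηc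
    have hbK : dPotT P b ∈ K := Submodule.mem_map_of_mem hbmem
    have horth : ⟪dPotT P b, zz⟫_ℝ = 0 := Submodule.inner_right_of_mem_orthogonal hbK hz
    have hzz : zz = resT1 P (fun x κ => Y x κ + cobd (fun y => -extT P a y) x κ) := by
      have h1 : zz = resT1 P Y - r := by rw [hyz]; abel
      rw [h1, ← har, dPotT_apply]
      ext p
      simp only [PiLp.sub_apply, resT1_apply, cobd]
      abel
    rw [hzz, dPotT_apply, hbext, inner_resT1] at horth
    exact horth

/-! ## §2 Orthogonality to the corner-trivial fields forces vanishing off the corners; summation by parts -/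

/-- `0 ∈ periodBox M` for `M ≥ 1`. [folklore] -/
theorem zero_mem_periodBox {M : ℕ} (hM : 1 ≤ M) : (0 : Site d) ∈ periodBox (d := d) M := by
  rw [mem_periodBox]; intro κ; simp only [Pi.zero_apply]; exact ⟨le_rfl, by exact_mod_cast hM⟩

/-- A `(M·N)`-periodic function shifts along `(M·N)•ℤ^d`. [folklore] -/
theorem periodic_block_shift {α : Type*} {M N : ℕ} {f : Site d → α}
    (hf : ∀ (x : Site d) (τ : Fin d), f (x + ((M * N : ℕ) : ℤ) • e τ) = f x) (z t v : Site d) :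
    f ((M : ℤ) • (z + (N : ℤ) • t) + v) = f ((M : ℤ) • z + v) := by
  have h : (M : ℤ) • (z + (N : ℤ) • t) + v = ((M : ℤ) • z + v) + ((M * N : ℕ) : ℤ) • t := by
    push_cast; rw [smul_add, smul_smul]; abel
  rw [h, periodic_smul_vec hf]

/-- **ORTHOGONAL TO `Ξ₀` ⇒ ZERO OFF THE CORNERS**: `M, N ≥ 1`; an `(M·N)`-periodic site function `f` with
`Σ_{x∈periodBox(M·N)} ⟪η x, f x⟫ = 0` for every `(M·N)`-periodic `η` vanishing on `M•ℤ^d` vanishes at every `M•z + v`,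
`v ∈ [0,M)^d ∖ {0}`. [folklore] -/
theorem eq_zero_offCorner_of_orthogonal {M N : ℕ} (hM : 1 ≤ M) (hN : 1 ≤ N) (f : Site d → E)
    (hf : ∀ (x : Site d) (τ : Fin d), f (x + ((M * N : ℕ) : ℤ) • e τ) = f x)
    (horth : ∀ η : Site d → E, (∀ (x : Site d) (τ : Fin d), η (x + ((M * N : ℕ) : ℤ) • e τ) = η x) →
      (∀ w : Site d, η ((M : ℤ) • w) = 0) → ∑ x ∈ periodBox (d := d) (M * N), ⟪η x, f x⟫_ℝ = 0) :
    ∀ (z v : Site d), v ∈ periodBox (d := d) M → v ≠ 0 → f ((M : ℤ) • z + v) = 0 := by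
  haveI : NeZero N := ⟨by omega⟩
  have h0 : (0 : Site d) ∈ periodBox (d := d) M := zero_mem_periodBox hM
  set η : Site d → E := fun x => if cmod M x = 0 then 0 else f x with hηdef
  have hηblock : ∀ (z v : Site d), v ∈ periodBox (d := d) M → v ≠ 0 → η ((M : ℤ) • z + v) = f ((M : ℤ) • z + v) := by
    intro z v hv hv0
    simp only [hηdef, (cdiv_cmod_block (M := M) (z := z) hv).2, if_neg hv0]
  have hηcorner : ∀ w : Site d, η ((M : ℤ) • w) = 0 := by
    intro w
    have hm := (cdiv_cmod_block (M := M) (z := w) h0).2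
    rw [add_zero] at hm
    simp only [hηdef, hm, if_true]
  have hηper : ∀ (x : Site d) (τ : Fin d), η (x + ((M * N : ℕ) : ℤ) • e τ) = η x := by
    intro x τ
    have hm := cmod_add_period (L := M) (N : ℤ) x τ
    have hP : ((M * N : ℕ) : ℤ) = (M : ℤ) * (N : ℤ) := by push_cast; ring
    simp only [hηdef, hP, hm]
    rw [← hP, hf]
  have hsq : ∀ z : Site d, ∑ v ∈ periodBox (d := d) M, ⟪η ((M : ℤ) • z + v), f ((M : ℤ) • z + v)⟫_ℝ
      = ∑ v ∈ (periodBox (d := d) M).erase 0, ‖f ((M : ℤ) • z + v)‖ ^ 2 := by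
    intro z
    rw [← add_sum_erase _ _ h0, add_zero, hηcorner, inner_zero_left, zero_add]
    exact sum_congr rfl fun v hv => by
      rw [hηblock z v (mem_of_mem_erase hv) (ne_of_mem_erase hv), real_inner_self_eq_norm_sq]
  have htot := horth η hηper hηcorner
  rw [← sum_periodBox_blocks M N hM (fun x => ⟪η x, f x⟫_ℝ), sum_congr rfl fun z _ => hsq z] at htot
  have hz : ∀ z ∈ periodBox (d := d) N, ∀ v ∈ (periodBox (d := d) M).erase 0, f ((M : ℤ) • z + v) = 0 := by
    intro z hz v hv
    have h1 := (sum_eq_zero_iff_of_nonneg fun z _ => sum_nonneg fun v _ => sq_nonneg _).1 htot z hz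
    have h2 := (sum_eq_zero_iff_of_nonneg fun v _ => sq_nonneg _).1 h1 v hv
    rwa [sq_eq_zero_iff, norm_eq_zero] at h2
  intro z v hv hv0
  have hz₀mem : boxVec N (redN N z) ∈ periodBox (d := d) N := by
    unfold periodBox; exact mem_image_of_mem _ (mem_univ _)
  rw [eq_wrap_add N z, periodic_block_shift hf]
  exact hz _ hz₀mem v (mem_erase_of_ne_of_mem hv0 hv)

/-- **`Σ_x Σ_κ ⟪cobd η x κ, Z x κ⟫ = −Σ_x ⟪η x, Σ_κ (Z x κ − Z (x − e_κ) κ)⟫`** on `periodBox P` for `P`-periodic `η`, `Z`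
((70S) `sum_inner_fd_eq_neg` in every direction). [folklore] -/
theorem sum_inner_cobd_eq_neg {P : ℕ} (hP : 1 ≤ P) (η : Site d → E) (Z : Site d → Fin d → E)
    (hη : ∀ (x : Site d) (τ : Fin d), η (x + (P : ℤ) • e τ) = η x)
    (hZ : ∀ (x : Site d) (τ μ : Fin d), Z (x + (P : ℤ) • e τ) μ = Z x μ) :
    ∑ x ∈ periodBox (d := d) P, ∑ κ : Fin d, ⟪cobd η x κ, Z x κ⟫_ℝ
      = -∑ x ∈ periodBox (d := d) P, ⟪η x, ∑ κ : Fin d, (Z x κ - Z (x - e κ) κ)⟫_ℝ := by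
  rw [Finset.sum_comm]
  have hκ : ∀ κ : Fin d, ∑ x ∈ periodBox (d := d) P, ⟪cobd η x κ, Z x κ⟫_ℝ
      = -∑ x ∈ periodBox (d := d) P, ⟪η x, Z x κ - Z (x - e κ) κ⟫_ℝ := by
    intro κ
    simp only [cobd]
    exact sum_inner_fd_eq_neg hP κ η (fun x => Z x κ) hη (fun x τ => hZ x τ κ)
  simp_rw [hκ]
  rw [← Finset.sum_neg_distrib]
  simp_rw [← Finset.sum_neg_distrib]
  rw [Finset.sum_comm]
  refine Finset.sum_congr rfl fun x _ => ?_
  rw [inner_sum, Finset.sum_neg_distrib]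

/-! ## §3 The projected-Landau representative -/

/-- **THE PROJECTED-LANDAU STEP**: `M, N ≥ 1`, `E` a finite-dimensional real inner product space; every `(M·N)`-periodic
`E`-valued lattice 1-form `Y` has an `(M·N)`-periodic CORNER-TRIVIAL site field `ξ` such that the backward divergence of
`Y + cobd ξ` VANISHES at every site off the corner lattice `M•ℤ^d`. [folklore] -/
theorem exists_projLandau_repr [FiniteDimensional ℝ E] {M N : ℕ} (hM : 1 ≤ M) (hN : 1 ≤ N)
    (Y : Site d → Fin d → E) (hY : ∀ (x : Site d) (τ μ : Fin d), Y (x + ((M * N : ℕ) : ℤ) • e τ) μ = Y x μ) :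
    ∃ ξ : Site d → E,
      (∀ (x : Site d) (τ : Fin d), ξ (x + ((M * N : ℕ) : ℤ) • e τ) = ξ x) ∧
      (∀ w : Site d, ξ ((M : ℤ) • w) = 0) ∧
      ∀ (z v : Site d), v ∈ periodBox (d := d) M → v ≠ 0 →
        ∑ κ : Fin d, ((Y ((M : ℤ) • z + v) κ + cobd ξ ((M : ℤ) • z + v) κ)
          - (Y ((M : ℤ) • z + v - e κ) κ + cobd ξ ((M : ℤ) • z + v - e κ) κ)) = 0 := by
  obtain ⟨ξ, hξP, hξc, horth⟩ := exists_orthogonal_repr₀ (d := d) (E := E) hM hN Y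
  refine ⟨ξ, hξP, hξc, ?_⟩
  have hP : 1 ≤ M * N := Nat.one_le_iff_ne_zero.mpr (Nat.mul_ne_zero (by omega) (by omega))
  set Z : Site d → Fin d → E := fun x κ => Y x κ + cobd ξ x κ with hZ
  have hZP : ∀ (x : Site d) (τ μ : Fin d), Z (x + ((M * N : ℕ) : ℤ) • e τ) μ = Z x μ := by
    intro x τ μ
    simp only [hZ, cobd, hY]
    rw [add_right_comm, hξP, hξP]
  set D : Site d → E := fun x => ∑ κ : Fin d, (Z x κ - Z (x - e κ) κ) with hD
  have hDP : ∀ (x : Site d) (τ : Fin d), D (x + ((M * N : ℕ) : ℤ) • e τ) = D x := by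
    intro x τ
    simp only [hD]
    refine sum_congr rfl fun κ _ => ?_
    rw [hZP, show x + ((M * N : ℕ) : ℤ) • e τ - e κ = (x - e κ) + ((M * N : ℕ) : ℤ) • e τ by abel, hZP]
  have hDorth : ∀ η : Site d → E, (∀ (x : Site d) (τ : Fin d), η (x + ((M * N : ℕ) : ℤ) • e τ) = η x) →
      (∀ w : Site d, η ((M : ℤ) • w) = 0) → ∑ x ∈ periodBox (d := d) (M * N), ⟪η x, D x⟫_ℝ = 0 := by
    intro η hηP hηc
    have h := horth η hηP hηc
    rw [sum_inner_cobd_eq_neg (d := d) hP η Z hηP hZP, neg_eq_zero] at h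
    exact h
  intro z v hv hv0
  exact eq_zero_offCorner_of_orthogonal hM hN D hDP hDorth z v hv hv0

end

end Summit.QuantumFields.BalabanUV.T4Continuum.NE3ProjectedLandauProjection
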